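import Summits.BirchSwinnertonDyer.BirchSwinnertonDyer.Theorems.Rank2Observatory2DescClCertBasic
import HarnessLib

/-!
# BirchSwinnertonDyer — rank ≥ 2 observatory: KERNEL-2DESC-CL v2.3 (TWO MONOGENIC VIEWS), brick 1 — the second generator `η` and two-view elements

HONEST FRAMING: per-curve certified theorems and census instruments; no claim on BSD in rank ≥ 2.

Design `b2b-bsdr2-cert-1/KERNEL-2DESC-CL.md` §7.4 (cert-1 gen 19).  The v2.0/v2.1 reflective certificates
(`ClFieldCert`, `ClCurveCert`, …) work prime by prime through the equation order `ℤ[α]` of `K = ℚ(α)`,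
`g(α) = 0`, and therefore only reach primes `p ∤ [𝓞 K : ℤ[α]]`.  For a field whose equation order is not
maximal, a SECOND GENERATOR `η = (u₀ + u₁α + u₂α²)/d ∈ 𝓞 K`, a root of another monic integer cubic
`h = X³ + a′X² + b′X + c′`, gives a second monogenic VIEW `ℤ[η] ⊆ 𝓞 K`; when the two indices are coprime every
prime of `K` is visible in one of the two views, and ALL of the v2.0 per-prime machinery (`PrimeEntry` rows, the
Dedekind–Kummer cover, class / membership / inverse / unit certificates) applies verbatim in that view, simply
instantiated at `θ := η`, `(a, b, c) := (a′, b′, c′)` — its soundness lemmas only ever assume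
`aeval θ (MonicCubic.poly a b c) = 0` and `finrank ℚ K = 3`.

This file supplies the only new glue that needs Lean:
* `TwoDescCl.etaCheck a b c u d a′ b′ c′` — the decidable certificate that `(u₀ + u₁α + u₂α²)` is a root of the
  `d`-scaled cubic `X³ + d a′X² + d²b′X + d³c′` (the existing `cubicAtCoords`), and `aeval_eta_eq_zero` —
  hence `η := (u₀ + u₁α + u₂α²)/d` is a root of `h` (so `MonicCubic.thetaInt` makes it an algebraic integer and
  every v2.0 lemma applies to it);
* `TwoDescCl.twoViewCheck a b c u d m₁ m₂ X Y` — the decidable consistency of a TWO-VIEW ELEMENT: an `x ∈ 𝓞 K`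
  carried as `X = m₁·x` in `α`-coordinates and `Y = m₂·x` in `η`-coordinates (`m₂·X(α) = m₁·Y(η)`, an
  `α`-coordinate identity after clearing the denominator `d²`), `twoView_eq`; with a Bezout pair
  `s m₁ + t m₂ = 1` (`bezoutCheck`) the element itself is `twoViewElt = s·X(α) + t·Y(η) ∈ 𝓞 K` and satisfies
  `m₁·x = X(α)`, `m₂·x = Y(η)` (`coe_twoViewElt_alpha`, `coe_twoViewElt_eta`); typically `m₁ ∣ d^∞`
  (`m₁ = 1` when `x ∈ ℤ[α]`) and `m₂ ∣ [𝓞 K : ℤ[η]]^∞`;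
* VALUATION DISPATCH (`alpha_dispatch`, `eta_dispatch`): at a prime `w ∋ p` with `p ∤ m₁`, membership and the
  valuation of `x` are those of `X(α)`; at a prime `w ∋ p` with `p ∤ m₂`, those of `Y(η)`
  (`natCast_not_mem_of_coprime`: an integer coprime to the residue characteristic is not in `w`).

Kernel sanity at the end: the cut-2c-A field `M7732` (`g = X³ + X² − 3X − 35`, `η = (−3 − 2α + α²)/2`,
`h = X³ + 61X − 32`) passes `etaCheck` by `decide +kernel`.

Sorry-free; axioms `propext`, `Classical.choice`, `Quot.sound`.
[cite: Cohen1993, §4.8.2 (prime decomposition in an order of conductor prime to p), §6.1 (integral bases of cubic fields)]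
[cite: Marcus2018, Ch. 3, Thm. 27]
-/

set_option linter.dupNamespace false

noncomputable section

open scoped Classical NumberField nonZeroDivisors

open Literature.NumberTheory.NumberFields Polynomial Module NumberField IsDedekindDomain Ideal

namespace Summit.BirchSwinnertonDyer.BirchSwinnertonDyer.Rank2Observatory.TwoDescCl

open TwoDescCubic

variable {K : Type*} [Field K] [NumberField K] {a b c : ℤ} {θ : K}

/-! ## The second generator `η` -/

/-- Certificate for the second generator: `0 < d` and `u(α)` is a root of the `d`-scaled cubic
`X³ + d a′ X² + d² b′ X + d³ c′` (so that `u(α)/d` is a root of `X³ + a′X² + b′X + c′`). Computable. [folklore] -/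
def etaCheck (a b c : ℤ) (u : ℤ × ℤ × ℤ) (d : ℕ) (a' b' c' : ℤ) : Bool :=
  decide (0 < d) &&
    decide (cubicAtCoords a b c ((d : ℤ) * a') ((d : ℤ) ^ 2 * b') ((d : ℤ) ^ 3 * c') u = (0, 0, 0))

/-- `η = (u₀ + u₁θ + u₂θ²) / d ∈ K`. [folklore] -/
def eta (θ : K) (u : ℤ × ℤ × ℤ) (d : ℕ) : K :=
  ((u.1 : K) + (u.2.1 : K) * θ + (u.2.2 : K) * θ ^ 2) / (d : K)

/-- `d · η = u(θ)`. [folklore] -/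
theorem natCast_mul_eta (θ : K) (u : ℤ × ℤ × ℤ) {d : ℕ} (hd : 0 < d) :
    (d : K) * eta θ u d = (u.1 : K) + (u.2.1 : K) * θ + (u.2.2 : K) * θ ^ 2 := by
  have hd' : (d : K) ≠ 0 := Nat.cast_ne_zero.mpr hd.ne'
  unfold eta
  field_simp

/-- `u(θ) = d · η` in terms of `lin`. [folklore] -/
theorem algebraMap_lin_eq_mul_eta (hθ : aeval θ (MonicCubic.poly a b c) = 0) (u : ℤ × ℤ × ℤ) {d : ℕ}
    (hd : 0 < d) : algebraMap (𝓞 K) K (lin hθ u.1 u.2.1 u.2.2) = (d : K) * eta θ u d := by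
  rw [algebraMap_lin, natCast_mul_eta θ u hd]

/-- **`h(η) = 0`** from the scaled coordinate identity. [folklore] -/
theorem aeval_eta_eq_zero (hθ : aeval θ (MonicCubic.poly a b c) = 0) {u : ℤ × ℤ × ℤ} {d : ℕ}
    {a' b' c' : ℤ} (h : etaCheck a b c u d a' b' c' = true) :
    aeval (eta θ u d) (MonicCubic.poly a' b' c') = 0 := by
  simp only [etaCheck, Bool.and_eq_true, decide_eq_true_eq] at h
  obtain ⟨hd, hcub⟩ := h
  have e := aeval_lin_eq_zero_of_coords hθ u hcub
  rw [algebraMap_lin_eq_mul_eta hθ u hd] at e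
  have hd' : (d : K) ≠ 0 := Nat.cast_ne_zero.mpr hd.ne'
  simp only [MonicCubic.poly, map_add, map_mul, map_pow, aeval_X, eq_intCast, map_intCast] at e ⊢
  push_cast at e ⊢
  have hd3 : (d : K) ^ 3 ≠ 0 := pow_ne_zero 3 hd'
  apply (mul_right_injective₀ hd3)
  simp only [mul_zero]
  linear_combination e

/-- `0 < d` from the certificate. -/
theorem pos_of_etaCheck {u : ℤ × ℤ × ℤ} {d : ℕ} {a' b' c' : ℤ} (h : etaCheck a b c u d a' b' c' = true) :
    0 < d := by
  simp only [etaCheck, Bool.and_eq_true, decide_eq_true_eq] at h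
  exact h.1

/-! ## Two-view elements -/

/-- Consistency certificate of a two-view element: `m₂ d² · X = m₁ · (d² Y₀ + d Y₁ u + Y₂ u²)` as
`α`-coordinate triples (i.e. `m₂ · X(α) = m₁ · Y(η)` multiplied by `d²`). Computable. [folklore] -/
def twoViewCheck (a b c : ℤ) (u : ℤ × ℤ × ℤ) (d m₁ m₂ : ℕ) (X Y : ℤ × ℤ × ℤ) : Bool :=
  decide (smulCoords ((m₂ : ℤ) * (d : ℤ) ^ 2) X =
    smulCoords (m₁ : ℤ) (smulCoords ((d : ℤ) ^ 2 * Y.1) (1, 0, 0) + smulCoords ((d : ℤ) * Y.2.1) u +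
      smulCoords Y.2.2 (MonicCubic.mulCoords a b c u u)))

/-- **`m₂ · X(α) = m₁ · Y(η)` in `K`** from the consistency certificate. [folklore] -/
theorem twoView_eq (hθ : aeval θ (MonicCubic.poly a b c) = 0) {u : ℤ × ℤ × ℤ} {d m₁ m₂ : ℕ} (hd : 0 < d)
    {a' b' c' : ℤ} (hη : aeval (eta θ u d) (MonicCubic.poly a' b' c') = 0) {X Y : ℤ × ℤ × ℤ}
    (h : twoViewCheck a b c u d m₁ m₂ X Y = true) :
    (m₂ : K) * algebraMap (𝓞 K) K (lin hθ X.1 X.2.1 X.2.2) =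
      (m₁ : K) * algebraMap (𝓞 K) K (lin hη Y.1 Y.2.1 Y.2.2) := by
  simp only [twoViewCheck, decide_eq_true_eq] at h
  have hτ : θ ^ 3 + (a : K) * θ ^ 2 + (b : K) * θ + (c : K) = 0 := by
    have := hθ
    simp only [MonicCubic.poly, map_add, map_mul, map_pow, aeval_X, eq_intCast, map_intCast] at this
    linear_combination this
  have e := congrArg (MonicCubic.evalCoords θ) h
  simp only [MonicCubic.evalCoords_add, evalCoords_smulCoords, MonicCubic.evalCoords_mulCoords hτ,
    evalCoords_one] at e
  have hu : MonicCubic.evalCoords θ u = (d : K) * eta θ u d := by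
    rw [natCast_mul_eta θ u hd]; simp only [MonicCubic.evalCoords]
  have hX : algebraMap (𝓞 K) K (lin hθ X.1 X.2.1 X.2.2) = MonicCubic.evalCoords θ X := by
    rw [algebraMap_lin]; simp only [MonicCubic.evalCoords]
  have hY : algebraMap (𝓞 K) K (lin hη Y.1 Y.2.1 Y.2.2) =
      (Y.1 : K) + (Y.2.1 : K) * eta θ u d + (Y.2.2 : K) * eta θ u d ^ 2 := algebraMap_lin hη _ _ _
  rw [hu] at e
  rw [hX, hY]
  have hd' : (d : K) ≠ 0 := Nat.cast_ne_zero.mpr hd.ne'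
  have hd2 : (d : K) ^ 2 ≠ 0 := pow_ne_zero 2 hd'
  apply (mul_right_injective₀ hd2)
  simp only
  push_cast at e
  linear_combination e

/-- Bezout certificate `s m₁ + t m₂ = 1` (so `gcd(m₁, m₂) = 1`). Computable. -/
def bezoutCheck (s t : ℤ) (m₁ m₂ : ℕ) : Bool := decide (s * m₁ + t * m₂ = 1)

/-- **The two-view element** `x = s·X(α) + t·Y(η) ∈ 𝓞 K` (`= X(α)/d = Y(η)/d′`). [folklore] -/
def twoViewElt (hθ : aeval θ (MonicCubic.poly a b c) = 0) {u : ℤ × ℤ × ℤ} {d : ℕ} {a' b' c' : ℤ}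
    (hη : aeval (eta θ u d) (MonicCubic.poly a' b' c') = 0) (s t : ℤ) (X Y : ℤ × ℤ × ℤ) : 𝓞 K :=
  (s : 𝓞 K) * lin hθ X.1 X.2.1 X.2.2 + (t : 𝓞 K) * lin hη Y.1 Y.2.1 Y.2.2

/-- `m₁ · x = X(α)`. [folklore] -/
theorem coe_twoViewElt_alpha (hθ : aeval θ (MonicCubic.poly a b c) = 0) {u : ℤ × ℤ × ℤ} {d m₁ m₂ : ℕ}
    (hd : 0 < d) {a' b' c' : ℤ} (hη : aeval (eta θ u d) (MonicCubic.poly a' b' c') = 0) {s t : ℤ}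
    (hb : bezoutCheck s t m₁ m₂ = true) {X Y : ℤ × ℤ × ℤ} (h : twoViewCheck a b c u d m₁ m₂ X Y = true) :
    (m₁ : K) * algebraMap (𝓞 K) K (twoViewElt hθ hη s t X Y) = algebraMap (𝓞 K) K (lin hθ X.1 X.2.1 X.2.2) := by
  simp only [bezoutCheck, decide_eq_true_eq] at hb
  have e := twoView_eq hθ hd hη h
  simp only [twoViewElt, map_add, map_mul, map_intCast]
  have hb' : (s : K) * (m₁ : K) + (t : K) * (m₂ : K) = 1 := by exact_mod_cast hb
  linear_combination (t : K) * e.symm + algebraMap (𝓞 K) K (lin hθ X.1 X.2.1 X.2.2) * hb'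

/-- `m₂ · x = Y(η)`. [folklore] -/
theorem coe_twoViewElt_eta (hθ : aeval θ (MonicCubic.poly a b c) = 0) {u : ℤ × ℤ × ℤ} {d m₁ m₂ : ℕ}
    (hd : 0 < d) {a' b' c' : ℤ} (hη : aeval (eta θ u d) (MonicCubic.poly a' b' c') = 0) {s t : ℤ}
    (hb : bezoutCheck s t m₁ m₂ = true) {X Y : ℤ × ℤ × ℤ} (h : twoViewCheck a b c u d m₁ m₂ X Y = true) :
    (m₂ : K) * algebraMap (𝓞 K) K (twoViewElt hθ hη s t X Y) = algebraMap (𝓞 K) K (lin hη Y.1 Y.2.1 Y.2.2) := by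
  simp only [bezoutCheck, decide_eq_true_eq] at hb
  have e := twoView_eq hθ hd hη h
  simp only [twoViewElt, map_add, map_mul, map_intCast]
  have hb' : (s : K) * (m₁ : K) + (t : K) * (m₂ : K) = 1 := by exact_mod_cast hb
  linear_combination (s : K) * e + algebraMap (𝓞 K) K (lin hη Y.1 Y.2.1 Y.2.2) * hb'

/-! ## Valuation dispatch -/

omit [NumberField K] in
/-- An integer coprime to the residue characteristic of `w` is not in `w`. [folklore] -/
theorem natCast_not_mem_of_coprime (w : HeightOneSpectrum (𝓞 K)) {p n : ℕ} (hp : (p : 𝓞 K) ∈ w.asIdeal)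
    (hn : Nat.Coprime n p) : (n : 𝓞 K) ∉ w.asIdeal := by
  intro hmem
  apply w.isPrime.ne_top
  rw [Ideal.eq_top_iff_one]
  have hg := Nat.gcd_eq_gcd_ab n p
  rw [Nat.Coprime.gcd_eq_one hn] at hg
  have : (1 : 𝓞 K) = (n : 𝓞 K) * (Nat.gcdA n p : 𝓞 K) + (p : 𝓞 K) * (Nat.gcdB n p : 𝓞 K) := by
    have := congrArg (fun z : ℤ => (z : 𝓞 K)) hg
    push_cast at this
    exact this
  rw [this]
  exact Ideal.add_mem _ (Ideal.mul_mem_right _ _ hmem) (Ideal.mul_mem_right _ _ hp)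

omit [NumberField K] in
/-- From `m · x = z` with `m ∉ w`: `x ∈ w ↔ z ∈ w`. [folklore] -/
theorem mem_iff_of_natCast_mul_eq (w : HeightOneSpectrum (𝓞 K)) {m : ℕ} (hm : (m : 𝓞 K) ∉ w.asIdeal)
    {x z : 𝓞 K} (h : (m : 𝓞 K) * x = z) : x ∈ w.asIdeal ↔ z ∈ w.asIdeal := by
  constructor
  · intro hx; rw [← h]; exact Ideal.mul_mem_left _ _ hx
  · intro hz; rw [← h] at hz
    exact ((w.isPrime.mem_or_mem hz).resolve_left hm)

/-- From `m · x = z` with `m ∉ w`: `v_w(x) = v_w(z)`. [folklore] -/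
theorem valuation_eq_of_natCast_mul_eq (w : HeightOneSpectrum (𝓞 K)) {m : ℕ} (hm : (m : 𝓞 K) ∉ w.asIdeal)
    {x z : 𝓞 K} (h : (m : 𝓞 K) * x = z) :
    w.valuation K (x : K) = w.valuation K (z : K) := by
  have hv : w.valuation K ((m : 𝓞 K) : K) = 1 := valuation_eq_one_of_not_mem w hm
  have := congrArg (fun y : 𝓞 K => w.valuation K (y : K)) h
  simp only [RingOfIntegers.coe_eq_algebraMap, map_mul] at this
  rw [RingOfIntegers.coe_eq_algebraMap, RingOfIntegers.coe_eq_algebraMap, ← this]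
  rw [RingOfIntegers.coe_eq_algebraMap] at hv
  rw [hv, one_mul]

/-- Integral form of `coe_twoViewElt_alpha`: `m₁ · x = X(α)` in `𝓞 K`. -/
theorem natCast_mul_twoViewElt_alpha (hθ : aeval θ (MonicCubic.poly a b c) = 0) {u : ℤ × ℤ × ℤ} {d m₁ m₂ : ℕ}
    (hd : 0 < d) {a' b' c' : ℤ} (hη : aeval (eta θ u d) (MonicCubic.poly a' b' c') = 0) {s t : ℤ}
    (hb : bezoutCheck s t m₁ m₂ = true) {X Y : ℤ × ℤ × ℤ} (h : twoViewCheck a b c u d m₁ m₂ X Y = true) :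
    (m₁ : 𝓞 K) * twoViewElt hθ hη s t X Y = lin hθ X.1 X.2.1 X.2.2 := by
  apply IsFractionRing.injective (𝓞 K) K
  rw [map_mul, map_natCast]
  exact coe_twoViewElt_alpha hθ hd hη hb h

/-- Integral form of `coe_twoViewElt_eta`: `m₂ · x = Y(η)` in `𝓞 K`. -/
theorem natCast_mul_twoViewElt_eta (hθ : aeval θ (MonicCubic.poly a b c) = 0) {u : ℤ × ℤ × ℤ} {d m₁ m₂ : ℕ}
    (hd : 0 < d) {a' b' c' : ℤ} (hη : aeval (eta θ u d) (MonicCubic.poly a' b' c') = 0) {s t : ℤ}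
    (hb : bezoutCheck s t m₁ m₂ = true) {X Y : ℤ × ℤ × ℤ} (h : twoViewCheck a b c u d m₁ m₂ X Y = true) :
    (m₂ : 𝓞 K) * twoViewElt hθ hη s t X Y = lin hη Y.1 Y.2.1 Y.2.2 := by
  apply IsFractionRing.injective (𝓞 K) K
  rw [map_mul, map_natCast]
  exact coe_twoViewElt_eta hθ hd hη hb h

/-- **α-view dispatch**: at a prime `w ∋ p` with `p ∤ m₁`, `x ∈ w ↔ X(α) ∈ w` and `v_w(x) = v_w(X(α))`. [folklore] -/
theorem alpha_dispatch (hθ : aeval θ (MonicCubic.poly a b c) = 0) {u : ℤ × ℤ × ℤ} {d m₁ m₂ : ℕ}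
    (hd : 0 < d) {a' b' c' : ℤ} (hη : aeval (eta θ u d) (MonicCubic.poly a' b' c') = 0) {s t : ℤ}
    (hb : bezoutCheck s t m₁ m₂ = true) {X Y : ℤ × ℤ × ℤ} (h : twoViewCheck a b c u d m₁ m₂ X Y = true)
    (w : HeightOneSpectrum (𝓞 K)) {p : ℕ} (hp : (p : 𝓞 K) ∈ w.asIdeal) (hpd : Nat.Coprime m₁ p) :
    (twoViewElt hθ hη s t X Y ∈ w.asIdeal ↔ lin hθ X.1 X.2.1 X.2.2 ∈ w.asIdeal) ∧
      w.valuation K ((twoViewElt hθ hη s t X Y : 𝓞 K) : K) =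
        w.valuation K ((lin hθ X.1 X.2.1 X.2.2 : 𝓞 K) : K) := by
  have hm := natCast_not_mem_of_coprime w hp hpd
  have e := natCast_mul_twoViewElt_alpha hθ hd hη hb h
  exact ⟨mem_iff_of_natCast_mul_eq w hm e, valuation_eq_of_natCast_mul_eq w hm e⟩

/-- **η-view dispatch**: at a prime `w ∋ p` with `p ∤ m₂`, `x ∈ w ↔ Y(η) ∈ w` and `v_w(x) = v_w(Y(η))`. [folklore] -/
theorem eta_dispatch (hθ : aeval θ (MonicCubic.poly a b c) = 0) {u : ℤ × ℤ × ℤ} {d m₁ m₂ : ℕ}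
    (hd : 0 < d) {a' b' c' : ℤ} (hη : aeval (eta θ u d) (MonicCubic.poly a' b' c') = 0) {s t : ℤ}
    (hb : bezoutCheck s t m₁ m₂ = true) {X Y : ℤ × ℤ × ℤ} (h : twoViewCheck a b c u d m₁ m₂ X Y = true)
    (w : HeightOneSpectrum (𝓞 K)) {p : ℕ} (hp : (p : 𝓞 K) ∈ w.asIdeal) (hpd : Nat.Coprime m₂ p) :
    (twoViewElt hθ hη s t X Y ∈ w.asIdeal ↔ lin hη Y.1 Y.2.1 Y.2.2 ∈ w.asIdeal) ∧
      w.valuation K ((twoViewElt hθ hη s t X Y : 𝓞 K) : K) =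
        w.valuation K ((lin hη Y.1 Y.2.1 Y.2.2 : 𝓞 K) : K) := by
  have hm := natCast_not_mem_of_coprime w hp hpd
  have e := natCast_mul_twoViewElt_eta hθ hd hη hb h
  exact ⟨mem_iff_of_natCast_mul_eq w hm e, valuation_eq_of_natCast_mul_eq w hm e⟩

/-! ## Kernel sanity: the cut-2c-A field `M7732` -/

/-- `g = X³ + X² − 3X − 35`, `η = (−3 − 2α + α²)/2`, `h = X³ + 61X − 32`. -/
example : etaCheck 1 (-3) (-35) (-3, -2, 1) 2 0 61 (-32) = true := by decide +kernel

/-- The two-view presentation of `η` itself: `X = 2·η = u(α) = (−3, −2, 1)` (`m₁ = d = 2`), `Y = η = (0, 1, 0)`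
(`m₂ = 1`), Bezout `0·2 + 1·1 = 1`. -/
example : twoViewCheck 1 (-3) (-35) (-3, -2, 1) 2 2 1 (-3, -2, 1) (0, 1, 0) = true := by decide +kernel

example : bezoutCheck 0 1 2 1 = true := by decide +kernel

end Summit.BirchSwinnertonDyer.BirchSwinnertonDyer.Rank2Observatory.TwoDescCl
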